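import Literature.MathematicalPhysics.QuantumLattice.LatticeGaugeDLR
import Literature.MathematicalPhysics.QuantumFieldTheory.ConstructiveQFTWave0
import Literature.RepresentationTheory.CompactGroups.UnitaryTrick
import Mathlib.Probability.ProductMeasure
import HarnessLib

/-!
# Crux `IR` (stmt-QuantumFields-19354), line `telescoped-coding` (ideator ym-ir-idea-4): the line's VOCABULARY as tree constants

Helper module for item `stmt-QuantumFields-19354` (`--supports … --as helper`).  The objects and the three coder FORMATS of skeleton v2
`Cruxes/IR/Lines/telescoped_coding.lean` (commit 120cd7667b0e) — `supDist`, `inputBall`, `Noise`, `seqNoise`, `edgeRep`, `blockField`,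
`HaarCodedSeq`, `CoarseCodedSeq`, `CondCodedSeq`, `CondBlockCodedSeq`, `jStar` — made tree constants VERBATIM (same namespace
`Summit.QuantumFields.YangMills.Cruxes.IR.TelescopedCoding`), so that the registered stubs (`stub_codedClustering`, `stub_composeCoders`,
`stub_composeCond`, …) can be closed by `Theorems/` files proving statements about THESE constants by name, and so that the two idea-4 skeletons
(`telescoped_coding.lean`, `smallfield_polymer_coder.lean`) re-base on `import …Theorems.IR.TelescopedCodingDefs` instead of each re-declaring them.
Nothing is asserted here: definitions only (the `…CodedSeq` are `Prop`-valued FORMATS with parameters, i.e. predicates, not claims).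

HONEST FRAMING: vocabulary of ONE conditional line of the OPEN gap-crux `IR`; the line's loads (T, U) are research-level and untouched; the
YM mass gap (Clay) is NOT proved; `R4` closes only the conditional rung `BalabanLadder.UV`.
Refs: T. Bałaban, CMP 95 (1984) 17 (1.4)–(1.6) (axial block holonomies); skeleton and cards `Cruxes/IR/Lines/telescoped_coding.{lean,md}`.
-/

set_option autoImplicit false

noncomputable section

open Filter Topology MeasureTheory
open Literature.MathematicalPhysics.QuantumFieldTheory Literature.MathematicalPhysics.QuantumLattice

namespace Summit.QuantumFields.YangMills.Cruxes.IR.TelescopedCoding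

/-! ## §1 Objects: sequence noise, input balls, block-holonomy field; the three formats (VERBATIM skeleton v2 §1) -/

section Format

variable {G : Type} [Group G] [TopologicalSpace G] [IsTopologicalGroup G] [CompactSpace G]
  [MeasurableSpace G] [BorelSpace G]

/-- Sup-distance of two sites of `ℤ⁴`. -/
def supDist (x y : Fin 4 → ℤ) : ℕ := Finset.univ.sup fun i => (x i - y i).natAbs

/-- **Input ball**: the torus links (side `S`) below the `ℤ⁴`-links whose base point is within sup-distance `R`
of the base point of `e`. -/
def inputBall (S : ℕ) (e : Literature.MathematicalPhysics.QuantumLattice.ZdEdge 4) (R : ℕ) :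
    Set (Literature.MathematicalPhysics.QuantumFieldTheory.Edge 4 S) :=
  torusEdge S '' {e' : Literature.MathematicalPhysics.QuantumLattice.ZdEdge 4 | supDist e'.1 e.1 ≤ R}

/-- The noise space: an `ℕ`-indexed sequence of group elements per torus link. -/
abbrev Noise (G : Type) (S : ℕ) : Type :=
  ℕ × Literature.MathematicalPhysics.QuantumFieldTheory.Edge 4 S → G

variable (G) in
/-- **Sequence Haar noise**: i.i.d. normalised Haar variables indexed by `ℕ × (torus links)`. -/
def seqNoise (S : ℕ) : Measure (Noise G S) :=
  haveI : IsProbabilityMeasure (haarProbability G) :=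
    Literature.RepresentationTheory.CompactGroups.CompactGroup.isProbabilityMeasure_haarMeasure_top
  Measure.infinitePi fun _ : ℕ × Literature.MathematicalPhysics.QuantumFieldTheory.Edge 4 S => haarProbability G

/-- The `ℤ⁴`-representative (coordinates in `[0, S)`) of a torus link. -/
def edgeRep (S : ℕ) (q : Literature.MathematicalPhysics.QuantumFieldTheory.Edge 4 S) :
    Literature.MathematicalPhysics.QuantumLattice.ZdEdge 4 :=
  (fun i => ((q.1 i).val : ℤ), q.2)

/-- **Block-holonomy field at block side `M`, fine-link-indexed, seam-exact.**  Partition the fundamental domain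
`[0,N)⁴` of the torus of side `N` into blocks `∏ₗ [M yₗ, min(M yₗ + M, N))`; the value at the torus link `q = (x, i)` is the
ordered product of the links `(M⌊x/M⌋ + j eᵢ, i)`, `0 ≤ j < M`, `M⌊xᵢ/M⌋ + j < N` — Bałaban's axial block link variable
(`axialBlockHolonomy`, `Literature/…/QuantumLattice/BalabanRG.lean`, CMP 95 (1984) (1.4)–(1.6)) of the block containing
`x`, with the last block in each direction TRUNCATED at the domain's edge rather than wrapped, so that for `M' ∣ M` every
`M`-block line is a concatenation of `M'`-block lines of the same partition (exact nesting on odd tori).  Block-constant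
by construction; for `M = 1` it is `U` itself. -/
def blockField (M N : ℕ) (U : GaugeConfig 4 N G) : GaugeConfig 4 N G := fun q =>
  (((List.range M).filter fun j => M * ((q.1 q.2).val / M) + j < N).map fun j =>
      U (torusEdge N
        ((fun l => ((M * ((q.1 l).val / M) : ℕ) : ℤ)) + Pi.single q.2 (j : ℤ), q.2))).prod

/-- **FORMAT C_K^seq — Haar-coded at radius `b` (sequence alphabet)**: on every odd torus of side `≥ b` the Wilson
measure is the push-forward of the sequence Haar noise under a measurable `Φ` whose output at each link agrees, off
a noise event of mass `≤ K e^{-k}`, with a measurable function of the noise in the input ball of radius `k·b`. -/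
def HaarCodedSeq {N : ℕ} (ρ : G →* Matrix (Fin N) (Fin N) ℂ) (K : ℝ) (β : ℝ) (b : ℕ) : Prop :=
  ∀ S : ℕ, b ≤ 2 * S + 1 →
    ∃ Φ : Noise G (2 * S + 1) → GaugeConfig 4 (2 * S + 1) G, Measurable Φ ∧
      (seqNoise G (2 * S + 1)).map Φ = wilsonMeasure (d := 4) (L := 2 * S + 1) ρ β ∧
      ∀ (e : Literature.MathematicalPhysics.QuantumLattice.ZdEdge 4) (k : ℕ), 1 ≤ k →
        ∃ Ψ : Noise G (2 * S + 1) → G, Measurable Ψ ∧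
          DependsOn Ψ {p | p.2 ∈ inputBall (2 * S + 1) e (k * b)} ∧
          seqNoise G (2 * S + 1) {ω | Φ ω (torusEdge (2 * S + 1) e) ≠ Ψ ω} ≤
            ENNReal.ofReal (K * Real.exp (-(k : ℝ)))

/-- **COARSE CODER at block side `M`, block radius `b₁`** («the block field at scale `M` is in the cluster region»):
on every odd torus of side `≥ M b₁` the LAW OF THE BLOCK-HOLONOMY FIELD is the push-forward of the sequence noise
under a measurable `Φ` whose output at each link agrees, off mass `≤ K e^{-k}`, with a function of the noise within
fine radius `k·(M b₁)` (i.e. `k b₁` blocks). -/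
def CoarseCodedSeq {N : ℕ} (ρ : G →* Matrix (Fin N) (Fin N) ℂ) (K : ℝ) (β : ℝ) (M b₁ : ℕ) : Prop :=
  ∀ S : ℕ, M * b₁ ≤ 2 * S + 1 →
    ∃ Φ : Noise G (2 * S + 1) → GaugeConfig 4 (2 * S + 1) G, Measurable Φ ∧
      (seqNoise G (2 * S + 1)).map Φ =
        (wilsonMeasure (d := 4) (L := 2 * S + 1) ρ β).map (blockField M (2 * S + 1)) ∧
      ∀ (e : Literature.MathematicalPhysics.QuantumLattice.ZdEdge 4) (k : ℕ), 1 ≤ k →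
        ∃ Ψ : Noise G (2 * S + 1) → G, Measurable Ψ ∧
          DependsOn Ψ {p | p.2 ∈ inputBall (2 * S + 1) e (k * (M * b₁))} ∧
          seqNoise G (2 * S + 1) {ω | Φ ω (torusEdge (2 * S + 1) e) ≠ Ψ ω} ≤
            ENNReal.ofReal (K * Real.exp (-(k : ℝ)))

/-- **CONDITIONAL CODER of the fine field given its blocks at side `M`, block radius `b₂`** («small-field + crossover
region below scale `M`»): on every odd torus of side `≥ M b₂` there is a measurable `Ψ (V, ω)` such that, for `V`
distributed as the block field of a Wilson sample and `ω` an independent sequence noise, `(V, Ψ (V, ω))` has the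
joint law of (block field, fine field) under the Wilson measure (an exact conditional sampler), and the output at
each link agrees, off an event of mass `≤ K e^{-k}`, with a function of `(V, ω)` restricted to fine radius
`k·(M b₂)`. -/
def CondCodedSeq {N : ℕ} (ρ : G →* Matrix (Fin N) (Fin N) ℂ) (K : ℝ) (β : ℝ) (M b₂ : ℕ) : Prop :=
  ∀ S : ℕ, M * b₂ ≤ 2 * S + 1 →
    ∃ Ψ : GaugeConfig 4 (2 * S + 1) G × Noise G (2 * S + 1) → GaugeConfig 4 (2 * S + 1) G, Measurable Ψ ∧
      (((wilsonMeasure (d := 4) (L := 2 * S + 1) ρ β).map (blockField M (2 * S + 1))).prod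
          (seqNoise G (2 * S + 1))).map (fun p => (p.1, Ψ p)) =
        (wilsonMeasure (d := 4) (L := 2 * S + 1) ρ β).map (fun U => (blockField M (2 * S + 1) U, U)) ∧
      ∀ (e : Literature.MathematicalPhysics.QuantumLattice.ZdEdge 4) (k : ℕ), 1 ≤ k →
        ∃ Ψ' : GaugeConfig 4 (2 * S + 1) G × Noise G (2 * S + 1) → G, Measurable Ψ' ∧
          (∀ p q : GaugeConfig 4 (2 * S + 1) G × Noise G (2 * S + 1),
            (∀ x ∈ inputBall (2 * S + 1) e (k * (M * b₂)), p.1 x = q.1 x) →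
            (∀ y : ℕ × Literature.MathematicalPhysics.QuantumFieldTheory.Edge 4 (2 * S + 1),
              y.2 ∈ inputBall (2 * S + 1) e (k * (M * b₂)) → p.2 y = q.2 y) → Ψ' p = Ψ' q) ∧
          (((wilsonMeasure (d := 4) (L := 2 * S + 1) ρ β).map (blockField M (2 * S + 1))).prod
              (seqNoise G (2 * S + 1))) {p | Ψ p (torusEdge (2 * S + 1) e) ≠ Ψ' p} ≤
            ENNReal.ofReal (K * Real.exp (-(k : ℝ)))

/-- **CONDITIONAL BLOCK CODER: the `M'`-block field given the `M`-block field (`M' ∣ M`), block radius `b`** — an exact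
conditional sampler `Ψ (V, ω)` of `blockField M' U` given `blockField M U = V`, local in `(V, ω)` at fine radius
`k·(M b)` off mass `≤ K e^{-k}`.  (For `M' = 1` this is a conditional coder of the fine field itself.) -/
def CondBlockCodedSeq {N : ℕ} (ρ : G →* Matrix (Fin N) (Fin N) ℂ) (K : ℝ) (β : ℝ) (M' M b : ℕ) : Prop :=
  ∀ S : ℕ, M * b ≤ 2 * S + 1 →
    ∃ Ψ : GaugeConfig 4 (2 * S + 1) G × Noise G (2 * S + 1) → GaugeConfig 4 (2 * S + 1) G, Measurable Ψ ∧
      (((wilsonMeasure (d := 4) (L := 2 * S + 1) ρ β).map (blockField M (2 * S + 1))).prod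
          (seqNoise G (2 * S + 1))).map (fun p => (p.1, Ψ p)) =
        (wilsonMeasure (d := 4) (L := 2 * S + 1) ρ β).map
          (fun U => (blockField M (2 * S + 1) U, blockField M' (2 * S + 1) U)) ∧
      ∀ (e : Literature.MathematicalPhysics.QuantumLattice.ZdEdge 4) (k : ℕ), 1 ≤ k →
        ∃ Ψ' : GaugeConfig 4 (2 * S + 1) G × Noise G (2 * S + 1) → G, Measurable Ψ' ∧
          (∀ p q : GaugeConfig 4 (2 * S + 1) G × Noise G (2 * S + 1),
            (∀ x ∈ inputBall (2 * S + 1) e (k * (M * b)), p.1 x = q.1 x) →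
            (∀ y : ℕ × Literature.MathematicalPhysics.QuantumFieldTheory.Edge 4 (2 * S + 1),
              y.2 ∈ inputBall (2 * S + 1) e (k * (M * b)) → p.2 y = q.2 y) → Ψ' p = Ψ' q) ∧
          (((wilsonMeasure (d := 4) (L := 2 * S + 1) ρ β).map (blockField M (2 * S + 1))).prod
              (seqNoise G (2 * S + 1))) {p | Ψ p (torusEdge (2 * S + 1) e) ≠ Ψ' p} ≤
            ENNReal.ofReal (K * Real.exp (-(k : ℝ)))

/-- **The minimal coded dyadic scale** `j⋆(β)` for constants `(K₁, b₁)`: the least `j` such that the `2^j`-block field is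
coarse-coded (`sInf`, junk value `0` when no dyadic scale is coded — the stubs below guard against it). -/
def jStar {N : ℕ} (ρ : G →* Matrix (Fin N) (Fin N) ℂ) (K₁ : ℝ) (b₁ : ℕ) (β : ℝ) : ℕ :=
  sInf {j : ℕ | CoarseCodedSeq ρ K₁ β (2 ^ j) b₁}

end Format

end Summit.QuantumFields.YangMills.Cruxes.IR.TelescopedCoding

end
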